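import Mathlib.MeasureTheory.Function.SpecialFunctions.Basic
import Mathlib.MeasureTheory.Function.SpecialFunctions.Inner
import Literature.Analysis.FluidPDE.CollisionCylinder
import HarnessLib

/-!
# The static collision tube: flight time, impact normal, parametrisation and scaling

Topic `Literature/MathematicalPhysics/KineticTheory` (kind proof; pure geometry of the tube predicate
of the fixed-time collision-tube functional `tubeStat` of `CollisionTubeFunctional.lean`, wanted by the
crux line `even-rung-mean-variance` of `JParityClosure.EvenStressEnskog`, stmt-AtomisticToContinuum-13079;
the measure-theoretic half is `CollisionTubeMeasure.lean`).

Two spheres of unit diameter at relative position `q` (`‖q‖ > 1`) with relative velocity `w` fly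
freely, `s ↦ q + s w`; with `a = ‖w‖²`, `b = ⟪q, w⟫`, `c = ‖q‖² − 1` they touch first at the
**flight time** `t_h = (−b − √(b² − ac))/a` (smaller root of `a s² + 2 b s + c = 0`), provided they
approach (`b < 0`) and the discriminant is nonnegative; the **impact normal** is `n_h = q + t_h w`
(Boltzmann's collision cylinder, CIP 1994 §2.2 / App. 4.A, GST 2013 §4.3, read statically):

* `flightTime w q`, `impactNormal w q`, the **strict tube** `strictTube κ w` (apart, approaching,
  POSITIVE discriminant, `t_h ≤ κ`) and the **weak tube** `weakTube κ w` (discriminant `≥ 0`: the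
  literal predicate of `tubeStat` at unit diameter); on their difference (grazing) the impact normal is
  orthogonal to `w` (`inner_impactNormal_eq_zero_of_grazing`).
* PARAMETRISATION: `q = ν − τ w` with `‖ν‖ = 1`, `⟪ν, w⟫ < 0`, `τ > 0` has `t_h = τ`, `n_h = ν`
  (`flightTime_sub_smul`, `impactNormal_sub_smul`) and lies in the strict tube iff `τ ≤ κ`; conversely
  every strict-tube point is of this form (`strictTube_spec`), so the strict tube lies in the open
  collision cylinder `collisionCylRegion 1 (−w)` of `CollisionCylinder.lean` and in the shell
  `1 < ‖q‖ ≤ 1 + κ‖w‖`.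
* MEASURABILITY of all of the above, jointly in `(w, q)`.
* SCALING to diameter `ε > 0` (`tubePred_iff_smul_mem_weakTube`, `flightTime_scale`,
  `impactNormal_scale`): the predicate and normal of `tubeStat` are those of `ε⁻¹ q` at unit scale.
* `tubeMark κ Ξ q v v'` — the mark `Ξ(n_h, v, v')` on the strict tube of `w = v − v'`, `0` off it:
  jointly measurable, bounded, supported in the shell; equal to the weak-tube mark for marks vanishing
  at grazing normals (`ite_weakTube_eq_tubeMark`).

## References

* C. Cercignani, R. Illner, M. Pulvirenti, *The Mathematical Theory of Dilute Gases* (1994), §2.2 and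
  App. 4.A p. 108 (collision cylinder).  [CIPDiluteGases1994]
* I. Gallagher, L. Saint-Raymond, B. Texier, *From Newton to Boltzmann* (2013), §4.3.
  [GallagherSaintRaymondTexier2013]
-/

noncomputable section

open MeasureTheory MeasureTheory.Measure Metric Set
open scoped ENNReal InnerProductSpace Classical
open Literature.Analysis.FluidPDE

namespace Literature.MathematicalPhysics.KineticTheory

variable {E : Type*} [NormedAddCommGroup E] [InnerProductSpace ℝ E]

/-! ## Definitions -/

/-- The **flight time to contact** at unit diameter: `t_h = (−b − √(b² − ac))/a` with `a = ‖w‖²`,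
`b = ⟪q, w⟫`, `c = ‖q‖² − 1` (smaller root of `a s² + 2bs + c = 0`; junk where the discriminant is
negative or `w = 0`). [cite: CIPDiluteGases1994, §2.2] -/
def flightTime (w q : E) : ℝ :=
  (-⟪q, w⟫_ℝ - Real.sqrt (⟪q, w⟫_ℝ ^ 2 - ‖w‖ ^ 2 * (‖q‖ ^ 2 - 1))) / ‖w‖ ^ 2

/-- The **predicted impact normal** `n_h = q + t_h w` at unit diameter. [cite: CIPDiluteGases1994, §2.2] -/
def impactNormal (w q : E) : E := q + flightTime w q • w

/-- The **strict collision tube** of flight-time window `κ` for relative velocity `w` at unit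
diameter: apart (`1 < ‖q‖`), approaching (`⟪q, w⟫ < 0`), POSITIVE discriminant, `t_h ≤ κ`.
[cite: CIPDiluteGases1994, §2.2] -/
def strictTube (κ : ℝ) (w : E) : Set E :=
  {q | 1 < ‖q‖ ∧ ⟪q, w⟫_ℝ < 0 ∧ ‖w‖ ^ 2 * (‖q‖ ^ 2 - 1) < ⟪q, w⟫_ℝ ^ 2 ∧ flightTime w q ≤ κ}

/-- The **weak collision tube** (discriminant `≥ 0`): verbatim the tube predicate of `tubeStat` at
unit diameter. [cite: CIPDiluteGases1994, §2.2] -/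
def weakTube (κ : ℝ) (w : E) : Set E :=
  {q | 1 < ‖q‖ ∧ ⟪q, w⟫_ℝ < 0 ∧ ‖w‖ ^ 2 * (‖q‖ ^ 2 - 1) ≤ ⟪q, w⟫_ℝ ^ 2 ∧ flightTime w q ≤ κ}

/-- The strict tube lies in the weak tube. [folklore] -/
theorem strictTube_subset_weakTube (κ : ℝ) (w : E) : strictTube κ w ⊆ weakTube κ w :=
  fun _ ⟨h1, h2, h3, h4⟩ => ⟨h1, h2, h3.le, h4⟩

/-! ## The parametrisation `q = ν − τ w` -/

section Param

variable {ν w : E} {τ : ℝ}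

/-- `⟪ν − τ w, w⟫ = ⟪ν, w⟫ − τ ‖w‖²`. [folklore] -/
theorem inner_sub_smul_self (ν w : E) (τ : ℝ) : ⟪ν - τ • w, w⟫_ℝ = ⟪ν, w⟫_ℝ - τ * ‖w‖ ^ 2 := by
  rw [inner_sub_left, real_inner_smul_left, real_inner_self_eq_norm_sq]

/-- `‖ν − τ w‖² = 1 − 2τ⟪ν, w⟫ + τ²‖w‖²` for a unit vector `ν`. [folklore] -/
theorem norm_sub_smul_sq (hν : ‖ν‖ = 1) (w : E) (τ : ℝ) :
    ‖ν - τ • w‖ ^ 2 = 1 - 2 * τ * ⟪ν, w⟫_ℝ + τ ^ 2 * ‖w‖ ^ 2 := by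
  rw [norm_sub_sq_real, hν, inner_smul_right, norm_smul, mul_pow, Real.norm_eq_abs, sq_abs]
  ring

/-- The discriminant at `q = ν − τ w` is `⟪ν, w⟫²`. [folklore] -/
theorem disc_sub_smul (hν : ‖ν‖ = 1) (w : E) (τ : ℝ) :
    ⟪ν - τ • w, w⟫_ℝ ^ 2 - ‖w‖ ^ 2 * (‖ν - τ • w‖ ^ 2 - 1) = ⟪ν, w⟫_ℝ ^ 2 := by
  rw [inner_sub_smul_self, norm_sub_smul_sq hν]
  ring

/-- **The flight time of `ν − τ w` is `τ`** (`‖ν‖ = 1`, `⟪ν, w⟫ < 0`, `τ > 0`). [cite: CIPDiluteGases1994, App. 4.A] -/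
theorem flightTime_sub_smul (hν : ‖ν‖ = 1) (hνw : ⟪ν, w⟫_ℝ < 0) (τ : ℝ) :
    flightTime w (ν - τ • w) = τ := by
  have hw : w ≠ 0 := fun h => by rw [h, inner_zero_right] at hνw; exact lt_irrefl _ hνw
  have ha : 0 < ‖w‖ ^ 2 := by positivity
  unfold flightTime
  rw [disc_sub_smul hν, Real.sqrt_sq_eq_abs, abs_of_neg hνw, inner_sub_smul_self]
  field_simp
  ring

/-- **The impact normal of `ν − τ w` is `ν`.** [cite: CIPDiluteGases1994, App. 4.A] -/
theorem impactNormal_sub_smul (hν : ‖ν‖ = 1) (hνw : ⟪ν, w⟫_ℝ < 0) (τ : ℝ) :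
    impactNormal w (ν - τ • w) = ν := by
  unfold impactNormal
  rw [flightTime_sub_smul hν hνw τ, sub_add_cancel]

/-- **`ν − τ w` lies in the strict tube iff `τ ≤ κ`.** [cite: CIPDiluteGases1994, §2.2] -/
theorem sub_smul_mem_strictTube_iff {κ : ℝ} (hν : ‖ν‖ = 1) (hνw : ⟪ν, w⟫_ℝ < 0) (hτ : 0 < τ) :
    ν - τ • w ∈ strictTube κ w ↔ τ ≤ κ := by
  have hw : w ≠ 0 := fun h => by rw [h, inner_zero_right] at hνw; exact lt_irrefl _ hνw
  have ha : 0 < ‖w‖ ^ 2 := by positivity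
  have hp : 0 < ⟪ν, w⟫_ℝ ^ 2 := by have := pow_pos (neg_pos.mpr hνw) 2; rwa [neg_sq] at this
  have hq2 : 1 < ‖ν - τ • w‖ ^ 2 := by
    rw [norm_sub_smul_sq hν]
    nlinarith [mul_pos hτ ha, mul_pos hτ (neg_pos.mpr hνw)]
  have h1 : 1 < ‖ν - τ • w‖ := lt_of_pow_lt_pow_left₀ 2 (norm_nonneg _) (by rwa [one_pow])
  have h2 : ⟪ν - τ • w, w⟫_ℝ < 0 := by
    rw [inner_sub_smul_self]; nlinarith [mul_pos hτ ha]
  have h3 : ‖w‖ ^ 2 * (‖ν - τ • w‖ ^ 2 - 1) < ⟪ν - τ • w, w⟫_ℝ ^ 2 := by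
    have e := disc_sub_smul hν w τ
    linarith
  simp only [strictTube, mem_setOf_eq, flightTime_sub_smul hν hνw τ]
  exact ⟨fun h => h.2.2.2, fun h => ⟨h1, h2, h3, h⟩⟩

end Param

/-! ## Structure of the strict tube -/

/-- **Every strict-tube point is `n_h − t_h w`** with `t_h > 0`, `‖n_h‖ = 1`, `⟪n_h, w⟫ < 0`.
[cite: CIPDiluteGases1994, §2.2] -/
theorem strictTube_spec {κ : ℝ} {w q : E} (hq : q ∈ strictTube κ w) :
    0 < flightTime w q ∧ ‖impactNormal w q‖ = 1 ∧ ⟪impactNormal w q, w⟫_ℝ < 0 ∧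
      q = impactNormal w q - flightTime w q • w := by
  obtain ⟨h1, h2, h3, -⟩ := hq
  have hw : w ≠ 0 := fun h => by rw [h, inner_zero_right] at h2; exact lt_irrefl _ h2
  set a := ‖w‖ ^ 2 with ha'
  set b := ⟪q, w⟫_ℝ with hb'
  set c := ‖q‖ ^ 2 - 1 with hc'
  have ha : 0 < a := by rw [ha']; positivity
  have hc : 0 < c := by
    rw [hc', sub_pos]
    have := pow_lt_pow_left₀ h1 zero_le_one (n := 2) two_ne_zero
    rwa [one_pow] at this
  have hD : 0 < b ^ 2 - a * c := by linarith
  set s := Real.sqrt (b ^ 2 - a * c) with hs'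
  have hs0 : 0 < s := Real.sqrt_pos.2 hD
  have hs2 : s ^ 2 = b ^ 2 - a * c := Real.sq_sqrt hD.le
  have hsb : s < -b := by
    have h' : s ^ 2 < (-b) ^ 2 := by rw [hs2, neg_sq]; nlinarith [mul_pos ha hc]
    exact lt_of_pow_lt_pow_left₀ 2 (by linarith) h'
  have hth : flightTime w q = (-b - s) / a := rfl
  have hth0 : 0 < flightTime w q := by rw [hth]; exact div_pos (by linarith) ha
  have hroot : a * flightTime w q ^ 2 + 2 * b * flightTime w q + c = 0 := by
    have e : a * ((-b - s) / a) ^ 2 + 2 * b * ((-b - s) / a) + c = (s ^ 2 - (b ^ 2 - a * c)) / a := by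
      field_simp
      ring
    rw [hth, e, hs2, sub_self, zero_div]
  have hn2 : ‖impactNormal w q‖ ^ 2 = 1 := by
    have e : ‖impactNormal w q‖ ^ 2 = ‖q‖ ^ 2 + 2 * (flightTime w q * b) + flightTime w q ^ 2 * a := by
      show ‖q + flightTime w q • w‖ ^ 2 = _
      rw [norm_add_sq_real, inner_smul_right, norm_smul, mul_pow, Real.norm_eq_abs, sq_abs]
    have hq2 : ‖q‖ ^ 2 = c + 1 := by rw [hc']; ring
    rw [e, hq2]
    linear_combination hroot
  have hn1 : ‖impactNormal w q‖ = 1 := by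
    have h := (sq_eq_sq₀ (norm_nonneg (impactNormal w q)) zero_le_one).1 (by rw [hn2, one_pow])
    exact h
  have hnw : ⟪impactNormal w q, w⟫_ℝ = -s := by
    show ⟪q + flightTime w q • w, w⟫_ℝ = -s
    rw [inner_add_left, real_inner_smul_left, real_inner_self_eq_norm_sq, hth]
    field_simp
    ring
  refine ⟨hth0, hn1, by rw [hnw]; linarith, ?_⟩
  show q = q + flightTime w q • w - flightTime w q • w
  rw [add_sub_cancel_right]

/-- **The strict tube lies in the open collision cylinder** `collisionCylRegion 1 (−w)` of
`CollisionCylinder.lean` (`q = 1 • n_h + t_h • (−w)`, `⟪−w, n_h⟫ > 0`). [cite: CIPDiluteGases1994, App. 4.A] -/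
theorem strictTube_subset_collisionCylRegion (κ : ℝ) (w : E) :
    strictTube κ w ⊆ collisionCylRegion 1 (-w) := by
  intro q hq
  obtain ⟨hth0, hn1, hnw, hq'⟩ := strictTube_spec hq
  refine ⟨flightTime w q • impactNormal w q, ?_, ?_⟩
  · show 0 < ⟪-w, flightTime w q • impactNormal w q⟫_ℝ
    rw [inner_smul_right, inner_neg_left, real_inner_comm]
    exact mul_pos hth0 (by linarith)
  · rw [collisionCylMap_smul_unit 1 (-w) hn1 hth0, one_smul, smul_neg, ← sub_eq_add_neg]
    exact hq'.symm

/-- **The strict tube lies in the thin shell** `1 < ‖q‖ ≤ 1 + κ‖w‖`. [cite: CIPDiluteGases1994, §2.2] -/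
theorem strictTube_subset_shell (κ : ℝ) (w : E) :
    strictTube κ w ⊆ {q | 1 < ‖q‖ ∧ ‖q‖ ≤ 1 + κ * ‖w‖} := by
  intro q hq
  obtain ⟨hth0, hn1, -, hq'⟩ := strictTube_spec hq
  refine ⟨hq.1, ?_⟩
  calc ‖q‖ = ‖impactNormal w q - flightTime w q • w‖ := by rw [← hq']
    _ ≤ ‖impactNormal w q‖ + ‖flightTime w q • w‖ := norm_sub_le _ _
    _ = 1 + flightTime w q * ‖w‖ := by rw [hn1, norm_smul, Real.norm_of_nonneg hth0.le]
    _ ≤ 1 + κ * ‖w‖ := by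
        have := mul_le_mul_of_nonneg_right hq.2.2.2 (norm_nonneg w)
        linarith

/-- **Grazing points of the weak tube have impact normal orthogonal to `w`** (zero discriminant:
`t_h = −b/a`, `⟪q + t_h w, w⟫ = b − b = 0`). [cite: CIPDiluteGases1994, §2.2] -/
theorem inner_impactNormal_eq_zero_of_grazing {κ : ℝ} {w q : E} (hq : q ∈ weakTube κ w)
    (hq' : q ∉ strictTube κ w) : ⟪impactNormal w q, w⟫_ℝ = 0 := by
  obtain ⟨h1, h2, h3, h4⟩ := hq
  have heq : ‖w‖ ^ 2 * (‖q‖ ^ 2 - 1) = ⟪q, w⟫_ℝ ^ 2 := by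
    by_contra hne
    exact hq' ⟨h1, h2, lt_of_le_of_ne h3 hne, h4⟩
  have hw : w ≠ 0 := fun h => by rw [h, inner_zero_right] at h2; exact lt_irrefl _ h2
  have ha : 0 < ‖w‖ ^ 2 := by positivity
  show ⟪q + flightTime w q • w, w⟫_ℝ = 0
  rw [inner_add_left, real_inner_smul_left, real_inner_self_eq_norm_sq, flightTime, ← heq, sub_self,
    Real.sqrt_zero, sub_zero]
  field_simp
  ring

/-! ## Measurability -/

/-- The impact normal is continuous in `q`. [folklore] -/
theorem continuous_impactNormal (w : E) : Continuous (impactNormal w) := by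
  unfold impactNormal flightTime; fun_prop

section Meas

variable [MeasurableSpace E] [BorelSpace E] [SecondCountableTopology E]

/-- The flight time is jointly measurable in `(w, q)`. [folklore] -/
theorem measurable_flightTime₂ : Measurable fun p : E × E => flightTime p.1 p.2 := by
  unfold flightTime; fun_prop

/-- The impact normal is jointly measurable in `(w, q)`. [folklore] -/
theorem measurable_impactNormal₂ : Measurable fun p : E × E => impactNormal p.1 p.2 := by
  unfold impactNormal flightTime; fun_prop

omit [SecondCountableTopology E] in
/-- The impact normal is measurable in `q`. [folklore] -/
theorem measurable_impactNormal (w : E) : Measurable (impactNormal w) :=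
  (continuous_impactNormal w).measurable

/-- The strict tube is jointly measurable in `(w, q)`. [folklore] -/
theorem measurableSet_strictTube₂ (κ : ℝ) : MeasurableSet {p : E × E | p.2 ∈ strictTube κ p.1} := by
  have h1 : Measurable fun p : E × E => ‖p.2‖ := by fun_prop
  have h2 : Measurable fun p : E × E => ⟪p.2, p.1⟫_ℝ := by fun_prop
  have h3 : Measurable fun p : E × E => ‖p.1‖ ^ 2 * (‖p.2‖ ^ 2 - 1) := by fun_prop
  have h4 : Measurable fun p : E × E => ⟪p.2, p.1⟫_ℝ ^ 2 := by fun_prop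
  simp only [strictTube, mem_setOf_eq]
  exact (measurableSet_lt measurable_const h1).inter ((measurableSet_lt h2 measurable_const).inter
    ((measurableSet_lt h3 h4).inter (measurableSet_le measurable_flightTime₂ measurable_const)))

/-- The strict tube is measurable. [folklore] -/
theorem measurableSet_strictTube (κ : ℝ) (w : E) : MeasurableSet (strictTube κ w) :=
  (measurableSet_strictTube₂ κ).preimage (measurable_const.prodMk measurable_id :
    Measurable fun q : E => (w, q))

/-- The weak tube is jointly measurable in `(w, q)`. [folklore] -/
theorem measurableSet_weakTube₂ (κ : ℝ) : MeasurableSet {p : E × E | p.2 ∈ weakTube κ p.1} := by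
  have h1 : Measurable fun p : E × E => ‖p.2‖ := by fun_prop
  have h2 : Measurable fun p : E × E => ⟪p.2, p.1⟫_ℝ := by fun_prop
  have h3 : Measurable fun p : E × E => ‖p.1‖ ^ 2 * (‖p.2‖ ^ 2 - 1) := by fun_prop
  have h4 : Measurable fun p : E × E => ⟪p.2, p.1⟫_ℝ ^ 2 := by fun_prop
  simp only [weakTube, mem_setOf_eq]
  exact (measurableSet_lt measurable_const h1).inter ((measurableSet_lt h2 measurable_const).inter
    ((measurableSet_le h3 h4).inter (measurableSet_le measurable_flightTime₂ measurable_const)))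

end Meas

/-! ## Scaling to diameter `ε` -/

section Scale

variable {ε : ℝ}

/-- **Scaling of the flight time**: the `tubeStat` flight time at diameter `ε` is `ε t_h(ε⁻¹ q)`. [folklore] -/
theorem flightTime_scale (hε : 0 < ε) (q w : E) :
    (-⟪q, w⟫_ℝ - Real.sqrt (⟪q, w⟫_ℝ ^ 2 - ‖w‖ ^ 2 * (‖q‖ ^ 2 - ε ^ 2))) / ‖w‖ ^ 2 =
      ε * flightTime w (ε⁻¹ • q) := by
  have h1 : ⟪ε⁻¹ • q, w⟫_ℝ = ε⁻¹ * ⟪q, w⟫_ℝ := real_inner_smul_left _ _ _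
  have h2 : ‖ε⁻¹ • q‖ ^ 2 = ε⁻¹ ^ 2 * ‖q‖ ^ 2 := by
    rw [norm_smul, mul_pow, Real.norm_eq_abs, abs_of_pos (inv_pos.2 hε)]
  have h3 : ⟪ε⁻¹ • q, w⟫_ℝ ^ 2 - ‖w‖ ^ 2 * (‖ε⁻¹ • q‖ ^ 2 - 1) =
      ε⁻¹ ^ 2 * (⟪q, w⟫_ℝ ^ 2 - ‖w‖ ^ 2 * (‖q‖ ^ 2 - ε ^ 2)) := by
    rw [h1, h2]; field_simp
  unfold flightTime
  rw [h3, Real.sqrt_mul (by positivity), Real.sqrt_sq (by positivity), h1]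
  field_simp

/-- **Scaling of the impact normal**: the `tubeStat` normal `ε⁻¹(q + t_h w)` at diameter `ε` is the
unit-scale impact normal of `ε⁻¹ q`. [folklore] -/
theorem impactNormal_scale (hε : 0 < ε) (q w : E) :
    ε⁻¹ • (q + ((-⟪q, w⟫_ℝ - Real.sqrt (⟪q, w⟫_ℝ ^ 2 - ‖w‖ ^ 2 * (‖q‖ ^ 2 - ε ^ 2))) / ‖w‖ ^ 2) • w) =
      impactNormal w (ε⁻¹ • q) := by
  rw [flightTime_scale hε, impactNormal, smul_add, smul_smul, inv_mul_cancel_left₀ hε.ne']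

/-- **Scaling of the tube predicate**: the `tubeStat` predicate at diameter `ε` holds for `(q, w)` iff
`ε⁻¹ q` lies in the weak unit tube of `w`. [folklore] -/
theorem tubePred_iff_smul_mem_weakTube {κ : ℝ} (hε : 0 < ε) (q w : E) :
    (ε < ‖q‖ ∧ ⟪q, w⟫_ℝ < 0 ∧ ‖w‖ ^ 2 * (‖q‖ ^ 2 - ε ^ 2) ≤ ⟪q, w⟫_ℝ ^ 2 ∧
      (-⟪q, w⟫_ℝ - Real.sqrt (⟪q, w⟫_ℝ ^ 2 - ‖w‖ ^ 2 * (‖q‖ ^ 2 - ε ^ 2))) / ‖w‖ ^ 2 ≤ κ * ε) ↔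
    ε⁻¹ • q ∈ weakTube κ w := by
  have hε' : 0 < ε⁻¹ := inv_pos.2 hε
  have h1 : ⟪ε⁻¹ • q, w⟫_ℝ = ε⁻¹ * ⟪q, w⟫_ℝ := real_inner_smul_left _ _ _
  have hn : ‖ε⁻¹ • q‖ = ε⁻¹ * ‖q‖ := by rw [norm_smul, Real.norm_eq_abs, abs_of_pos hε']
  have h2 : ‖ε⁻¹ • q‖ ^ 2 = ε⁻¹ ^ 2 * ‖q‖ ^ 2 := by rw [hn, mul_pow]
  have e1 : ε < ‖q‖ ↔ 1 < ‖ε⁻¹ • q‖ := by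
    rw [hn, lt_inv_mul_iff₀ hε, mul_one]
  have e2 : ⟪q, w⟫_ℝ < 0 ↔ ⟪ε⁻¹ • q, w⟫_ℝ < 0 := by
    rw [h1, ← mul_lt_mul_iff_right₀ hε' (b := ⟪q, w⟫_ℝ) (c := 0), mul_zero]
  have e3 : ‖w‖ ^ 2 * (‖q‖ ^ 2 - ε ^ 2) ≤ ⟪q, w⟫_ℝ ^ 2 ↔
      ‖w‖ ^ 2 * (‖ε⁻¹ • q‖ ^ 2 - 1) ≤ ⟪ε⁻¹ • q, w⟫_ℝ ^ 2 := by
    rw [← sub_nonneg, iff_comm, ← sub_nonneg]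
    have e : ⟪ε⁻¹ • q, w⟫_ℝ ^ 2 - ‖w‖ ^ 2 * (‖ε⁻¹ • q‖ ^ 2 - 1) =
        ε⁻¹ ^ 2 * (⟪q, w⟫_ℝ ^ 2 - ‖w‖ ^ 2 * (‖q‖ ^ 2 - ε ^ 2)) := by
      rw [h1, h2]; field_simp
    rw [e, mul_nonneg_iff_of_pos_left (by positivity)]
  have e4 : (-⟪q, w⟫_ℝ - Real.sqrt (⟪q, w⟫_ℝ ^ 2 - ‖w‖ ^ 2 * (‖q‖ ^ 2 - ε ^ 2))) / ‖w‖ ^ 2 ≤ κ * ε ↔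
      flightTime w (ε⁻¹ • q) ≤ κ := by
    rw [flightTime_scale hε, mul_comm κ ε, mul_le_mul_iff_right₀ hε]
  simp only [weakTube, mem_setOf_eq]
  rw [e1, e2, e3, e4]

end Scale

/-! ## The tube mark -/

/-- **The tube mark** of flight-time window `κ` and pair mark `Ξ`: `Ξ(n_h(q), v, v')` if the unit-scale
relative position `q` lies in the strict tube of the relative velocity `w = v − v'`, and `0` otherwise
(one ordered pair's contribution to the collision-tube functional, density weight stripped). [cite: CIPDiluteGases1994, §2.2] -/
def tubeMark (κ : ℝ) (Ξ : E × E × E → ℝ) (q v v' : E) : ℝ :=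
  if q ∈ strictTube κ (v - v') then Ξ (impactNormal (v - v') q, v, v') else 0

/-- The weak-tube mark equals the tube mark for marks vanishing at grazing normals. [folklore] -/
theorem ite_weakTube_eq_tubeMark {κ : ℝ} {Ξ : E × E × E → ℝ}
    (hΞ : ∀ n v v' : E, ⟪n, v - v'⟫_ℝ = 0 → Ξ (n, v, v') = 0) (q v v' : E) :
    (if q ∈ weakTube κ (v - v') then Ξ (impactNormal (v - v') q, v, v') else 0) = tubeMark κ Ξ q v v' := by
  unfold tubeMark
  by_cases hs : q ∈ strictTube κ (v - v')
  · rw [if_pos (strictTube_subset_weakTube κ _ hs), if_pos hs]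
  · rw [if_neg hs]
    by_cases hw : q ∈ weakTube κ (v - v')
    · rw [if_pos hw]
      exact hΞ _ _ _ (inner_impactNormal_eq_zero_of_grazing hw hs)
    · rw [if_neg hw]

/-- The tube mark is bounded by any bound of the mark. [folklore] -/
theorem abs_tubeMark_le {κ : ℝ} {Ξ : E × E × E → ℝ} {C : ℝ} (hC : ∀ p, |Ξ p| ≤ C) (q v v' : E) :
    |tubeMark κ Ξ q v v'| ≤ C := by
  unfold tubeMark
  split_ifs
  · exact hC _
  · rw [abs_zero]; exact (abs_nonneg _).trans (hC (0, 0, 0))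

/-- The tube mark is supported in the strict tube, hence in the shell `1 < ‖q‖ ≤ 1 + κ‖v − v'‖`. [folklore] -/
theorem mem_shell_of_tubeMark_ne_zero {κ : ℝ} {Ξ : E × E × E → ℝ} {q v v' : E}
    (h : tubeMark κ Ξ q v v' ≠ 0) : 1 < ‖q‖ ∧ ‖q‖ ≤ 1 + κ * ‖v - v'‖ := by
  unfold tubeMark at h
  by_cases hs : q ∈ strictTube κ (v - v')
  · exact strictTube_subset_shell κ _ hs
  · exact absurd (if_neg hs) h

section MarkMeas

variable [MeasurableSpace E] [BorelSpace E] [SecondCountableTopology E]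

/-- **The tube mark is jointly measurable** in `(q, v, v')` for a measurable mark. [folklore] -/
theorem measurable_tubeMark (κ : ℝ) {Ξ : E × E × E → ℝ} (hΞ : Measurable Ξ) :
    Measurable fun p : E × E × E => tubeMark κ Ξ p.1 p.2.1 p.2.2 := by
  unfold tubeMark
  refine Measurable.ite ?_ ?_ measurable_const
  · exact (measurableSet_strictTube₂ κ).preimage
      ((measurable_snd.fst.sub measurable_snd.snd).prodMk measurable_fst)
  · exact hΞ.comp ((measurable_impactNormal₂.comp
      ((measurable_snd.fst.sub measurable_snd.snd).prodMk measurable_fst)).prodMk measurable_snd)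

/-- The tube mark is measurable in `q`. [folklore] -/
theorem measurable_tubeMark_left (κ : ℝ) {Ξ : E × E × E → ℝ} (hΞ : Measurable Ξ) (v v' : E) :
    Measurable fun q : E => tubeMark κ Ξ q v v' := by
  have h : Measurable fun q : E => (q, (v, v')) := measurable_id.prodMk measurable_const
  exact (measurable_tubeMark κ hΞ).comp h

end MarkMeas

end Literature.MathematicalPhysics.KineticTheory

end
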